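import Summits.ResolutionOfSingularities.ResolutionOfSingularities.Theorems.EquisingularLiftEquisingularLiftSectionBlowupIrreducibleLemmas
import Summits.ResolutionOfSingularities.ResolutionOfSingularities.Theorems.EquisingularLiftEquisingularLiftSectionBlowupFlatExceptional
import Summits.ResolutionOfSingularities.ResolutionOfSingularities.Theorems.EquisingularLiftEquisingularLiftSectionBlowupSpecialFibre
import Summits.ResolutionOfSingularities.ResolutionOfSingularities.Theorems.EquisingularLiftEquisingularLiftSectionComapPoint
import Summits.ResolutionOfSingularities.ResolutionOfSingularities.Theorems.EquisingularLiftEquisingularLiftSectionKer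
import Literature.AlgebraicGeometry.Resolution.BlowupsIntegral
import HarnessLib

/-!
# `EquisingularLift`, line `strata-split` — blowing up a section keeps the special fibre irreducible

Crux `stmt-ResolutionOfSingularities-15660` = `Theses.EquisingularLift.EquisingularLift`; helper sub-goal L1
(`isIrreducible_specialFibre_of_isBlowup_section`) of the registered stub `stub_resolveOnePoint_dimOne` (section
blow-up calculus over a DVR).

Setting: `O` a discrete valuation ring with closed point `s₀`, `r' : X' → Spec O` separated with `X'` integral,
`U ⊆ X'` an open which is smooth over `Spec O`, `s : Spec O → X'` a section of `r'` through `z₁ := s(s₀) ∈ U` with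
`ker s ≠ ⊥`, and `τ : X'' → X'` a blow-up of `X'` along `ker s` (universal property, `IsBlowup`). CLAIM: if the
special fibre `X'_s = r'⁻¹(s₀)` is irreducible, so is the special fibre `τ⁻¹(X'_s)` of `X'' → Spec O`.

Proof. `τ` is an isomorphism over `X' ∖ C`, `C = s(Spec O)` (`IsBlowup.isIso_compl`), and `C ∩ X'_s = {z₁}`, so
`A := τ⁻¹(X'_s ∖ {z₁}) ≅ X'_s ∖ {z₁}` is preirreducible and `τ⁻¹(X'_s) = A ∪ τ⁻¹(z₁)`; it remains to see that
`A ≠ ∅` and `τ⁻¹(z₁) ⊆ closure A` (`preimage_sectionPoint_subset_closure`). Both are local over `U`: the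
restriction `τ|_U` is the blow-up of `U` along the section `s_U` (`IsBlowup.restrict`); its exceptional divisor is
flat over `O` (`flat_exceptional_of_isBlowup_section`), so its base change `B → U_s` to the special fibre `U_s`
(smooth over the residue field, hence reduced) is the blow-up of `U_s` along `ker s_U · 𝒪_{U_s} = 𝔪_{z₁}`
(`isBlowup_specialFibre_of_flat_exceptional`, `ker_section_comap_eq_vanishingIdeal`). The scheme `U_s` is
integral (homeomorphic onto the open part `U ∩ X'_s` of the irreducible `X'_s`), and `𝔪_{z₁} ≠ ⊥` because
`U_s ≠ {z₁}` (`exists_mem_specialFibre_ne_of_section`, which also gives `A ≠ ∅`). Hence `B` is integral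
(`IsBlowup.isIntegral`) and its open part over `U_s ∖ {z₁}` is dense (`IsBlowup.dense_preimage_compl`); the image
of `B` in `X''` contains `τ⁻¹(z₁)` and its open part maps into `A`, so `τ⁻¹(z₁) ⊆ closure A`.

References: Q. Liu, *Algebraic Geometry and Arithmetic Curves* (2002), §8.1 (Prop. 8.1.12, Thm. 8.1.19); The
Stacks Project, Tags 02OS, 02ND, 0805.
-/

set_option linter.dupNamespace false -- mandated namespace `Summit.<Summit>.<Problem>` of this single-conjunct summit
set_option linter.overlappingInstances false -- the registered signature carries both [IsDomain O] and [IsDiscreteValuationRing O]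

noncomputable section

open CategoryTheory CategoryTheory.Limits AlgebraicGeometry TopologicalSpace Topology
open Literature.AlgebraicGeometry.Resolution

namespace Summit.ResolutionOfSingularities.ResolutionOfSingularities.Cruxes.EquisingularLift.StrataSplit

/-! ## The local analysis over the smooth open `U` -/

/-- **The exceptional fibre over the section point lies in the closure of the rest of the special fibre.** In the
setting of `isIrreducible_specialFibre_of_isBlowup_section`: `τ⁻¹(z₁) ⊆ closure (τ⁻¹(X'_s ∖ {z₁}))`, and some
point `u ∈ U` of the special fibre differs from `z₁ = s(s₀)`. Proof: base-change the blow-up `τ|_U` of `U` along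
the section to the special fibre `U_s` (a blow-up of the integral `U_s` at the reduced point `z₁`, by flatness of
the exceptional divisor), which is integral with dense open part over `U_s ∖ {z₁}`. [folklore] -/
theorem preimage_sectionPoint_subset_closure (O : Type) [CommRing O] [IsDomain O] [IsDiscreteValuationRing O]
    (X' X'' : Scheme.{0}) [IsIntegral X'] (r' : X' ⟶ Spec (.of O)) [IsSeparated r'] (U : X'.Opens)
    (hsm : Smooth (U.ι ≫ r')) (s : Spec (.of O) ⟶ X') (hs : s ≫ r' = 𝟙 _)
    (hzU : s (IsLocalRing.closedPoint O) ∈ U) (hker : s.ker ≠ ⊥) (τ : X'' ⟶ X') (hτ : IsBlowup τ s.ker)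
    (hirr : IsIrreducible (r' ⁻¹' {IsLocalRing.closedPoint O})) :
    τ ⁻¹' {s (IsLocalRing.closedPoint O)} ⊆
        closure (τ ⁻¹' (r' ⁻¹' {IsLocalRing.closedPoint O} \ {s (IsLocalRing.closedPoint O)})) ∧
      ∃ u : X', u ∈ U ∧ r' u = IsLocalRing.closedPoint O ∧ u ≠ s (IsLocalRing.closedPoint O) := by
  classical
  set s₀ := IsLocalRing.closedPoint O with hs₀def
  obtain ⟨hsCI, -, -, hsupp⟩ := section_isClosedImmersion_and_isRegular_ker O X' r' s hs
  haveI := hsCI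
  have hrs : ∀ t, r' (s t) = t := fun t => by
    rw [← Scheme.Hom.comp_apply, hs]; rfl
  -- (1) restrict to `U`: the section `sU` of `rU = U.ι ≫ r'` and the blow-up `τ ∣_ U` of `U` along `ker sU`
  let rU : (U : Scheme.{0}) ⟶ Spec (.of O) := U.ι ≫ r'
  haveI : Smooth rU := hsm
  haveI : IsSeparated rU := inferInstance
  have hrangeU : Set.range s ⊆ Set.range U.ι := by
    rw [Scheme.Opens.range_ι]
    rintro _ ⟨t, rfl⟩
    exact ((IsLocalRing.specializes_closedPoint t).map s.continuous).mem_open U.2 hzU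
  let sU : Spec (.of O) ⟶ (U : Scheme.{0}) := IsOpenImmersion.lift U.ι s hrangeU
  have hsUι : sU ≫ U.ι = s := IsOpenImmersion.lift_fac _ _ _
  have hsU : sU ≫ rU = 𝟙 _ := by rw [← Category.assoc, hsUι, hs]
  have hsUapp : ∀ t, U.ι (sU t) = s t := fun t => by
    rw [← Scheme.Hom.comp_apply, hsUι]
  have hkerU : sU.ker = s.ker.comap U.ι := by
    haveI : IsIso (pullback.snd U.ι s) := by
      refine isIso_of_isOpenImmersion_of_opensRange_eq_top _ ?_
      apply Opens.ext
      rw [Opens.coe_top, Scheme.Hom.coe_opensRange, Scheme.Pullback.range_snd]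
      exact Set.eq_univ_of_forall fun t => hrangeU ⟨t, rfl⟩
    have hfst : pullback.fst U.ι s = pullback.snd U.ι s ≫ sU := by
      rw [← cancel_mono U.ι, Category.assoc, hsUι, pullback.condition]
    rw [← Scheme.IdealSheafData.ker_fst_of_isClosedImmersion s U.ι, hfst, Scheme.Hom.ker_comp_of_isIso]
  have hτU : IsBlowup (τ ∣_ U) sU.ker := by
    rw [hkerU]; exact hτ.restrict U
  haveI : Nonempty (U : Scheme.{0}) := ⟨⟨_, hzU⟩⟩
  haveI : IsIntegral (U : Scheme.{0}) := isIntegral_of_isOpenImmersion U.ι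
  have hkerU' : sU.ker ≠ ⊥ := by
    intro h
    apply hker
    have h1 : ((sU.ker.support : Set U)) = Set.univ := by
      rw [h, Scheme.IdealSheafData.support_bot]; rfl
    rw [hkerU, Scheme.IdealSheafData.support_comap] at h1
    have h2 : (U : Set X') ⊆ s.ker.support := by
      intro x hx
      have : (⟨x, hx⟩ : U) ∈ (s.ker.support.preimage U.ι.continuous : Set U) := by
        rw [h1]; trivial
      exact this
    rw [← Scheme.IdealSheafData.support_eq_top_iff]
    apply TopologicalSpace.Closeds.ext
    rw [TopologicalSpace.Closeds.coe_top]
    apply Set.eq_univ_of_univ_subset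
    rw [← (U.2.dense ⟨_, hzU⟩).closure_eq]
    exact s.ker.support.isClosed.closure_subset_iff.mpr h2
  -- (2) the special fibre `Us` of `U` (reduced, integral) and the point `z₀` over `z₁`
  let ισ : Spec (.of (IsLocalRing.ResidueField O)) ⟶ Spec (.of O) :=
    Spec.map (CommRingCat.ofHom (IsLocalRing.residue O))
  haveI : IsClosedImmersion ισ :=
    IsClosedImmersion.spec_of_surjective _ IsLocalRing.residue_surjective
  haveI : IsLocalHom (CommRingCat.ofHom (IsLocalRing.residue O)).hom :=
    inferInstanceAs (IsLocalHom (IsLocalRing.residue O))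
  have hrangeσ : Set.range ισ = {s₀} := by
    ext t
    constructor
    · rintro ⟨x, rfl⟩
      rw [Subsingleton.elim x (IsLocalRing.closedPoint _)]
      exact Spec_closedPoint
    · rintro rfl
      exact ⟨IsLocalRing.closedPoint _, Spec_closedPoint⟩
  let i := pullback.fst rU ισ
  haveI : IsReduced (pullback rU ισ) := isReduced_of_smooth (pullback.snd rU ισ)
  have hirU : i ≫ rU = pullback.snd rU ισ ≫ ισ := pullback.condition
  have hrange_i : Set.range (i ≫ rU) ⊆ {s₀} := by
    rw [hirU, ← hrangeσ]
    rintro _ ⟨x, rfl⟩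
    exact ⟨_, (Scheme.Hom.comp_apply _ _ x).symm⟩
  have hrange_i' : Set.range i = rU ⁻¹' {s₀} := by
    change Set.range (pullback.fst rU ισ) = _
    rw [Scheme.Pullback.range_fst, hrangeσ]
  have hz₁U : rU (sU s₀) = s₀ := by rw [← Scheme.Hom.comp_apply, hsU]; rfl
  obtain ⟨z₀, hz₀⟩ : sU s₀ ∈ Set.range i := by rw [hrange_i']; exact hz₁U
  have hcl : IsClosed ({z₀} : Set ↑(pullback rU ισ)) := by
    obtain ⟨-, -, hcl1, -⟩ := section_isClosedImmersion_and_isRegular_ker O U rU sU hsU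
    have : ({z₀} : Set _) = i ⁻¹' {sU s₀} := by
      ext z
      simp only [Set.mem_singleton_iff, Set.mem_preimage]
      constructor
      · rintro rfl; exact hz₀
      · intro hz; exact i.isClosedEmbedding.injective (hz.trans hz₀.symm)
    rw [this]
    exact hcl1.preimage i.continuous
  -- `Us` is integral
  have hpreU : IsPreirreducible (U.ι ⁻¹' (r' ⁻¹' {s₀})) := hirr.2.preimage U.ι.isOpenEmbedding
  haveI : IsIntegral (pullback rU ισ) := by
    have h1 : IsPreirreducible (Set.range i) := by
      have : Set.range i = U.ι ⁻¹' (r' ⁻¹' {s₀}) := by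
        rw [hrange_i']; ext x; simp only [Set.mem_preimage, rU, Scheme.Hom.comp_apply]
      rw [this]
      exact hpreU
    have h2 : IsPreirreducible (Set.univ : Set ↑(pullback rU ισ)) := by
      have := isPreirreducible_preimage_of_isInducing i.isClosedEmbedding.isInducing h1 subset_rfl
      rwa [Set.preimage_range] at this
    haveI : PreirreducibleSpace ↑(pullback rU ισ) := ⟨h2⟩
    haveI : Nonempty ↑(pullback rU ισ) := ⟨z₀⟩
    haveI : IrreducibleSpace ↑(pullback rU ισ) := ⟨inferInstance⟩
    exact isIntegral_of_irreducibleSpace_of_isReduced _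
  -- (3) the base change `B → Us` of `τ ∣_ U` is the blow-up of `Us` at the reduced point `z₀`
  have hflat := flat_exceptional_of_isBlowup_section O U _ rU sU hsU (τ ∣_ U) hτU
  have hB := isBlowup_specialFibre_of_flat_exceptional O U _ rU sU (τ ∣_ U) hτU hflat
  have hJ := ker_section_comap_eq_vanishingIdeal O U (pullback rU ισ) rU sU hsU i hrange_i z₀ hz₀ hcl
  change IsBlowup (pullback.snd (τ ∣_ U) i) (sU.ker.comap i) at hB
  rw [hJ] at hB
  -- non-degeneracy: `Us ≠ {z₀}`, so the centre `𝔪_{z₀}` is a nonzero ideal sheaf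
  obtain ⟨u, hu0, hune⟩ := exists_mem_specialFibre_ne_of_section O U rU sU hsU hkerU'
  have hJne : Scheme.IdealSheafData.vanishingIdeal ⟨{z₀}, hcl⟩ ≠ ⊥ := by
    intro h
    have hsJ : (({z₀} : Set ↑(pullback rU ισ))) = Set.univ := by
      rw [← TopologicalSpace.Closeds.coe_top, ← Scheme.IdealSheafData.support_bot (X := pullback rU ισ), ← h,
        Scheme.IdealSheafData.coe_support_vanishingIdeal]
      rfl
    obtain ⟨w, hw⟩ : u ∈ Set.range i := by rw [hrange_i']; exact hu0
    have hwz : w = z₀ := by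
      have : w ∈ ({z₀} : Set _) := by rw [hsJ]; trivial
      exact this
    exact hune (by rw [← hw, hwz, hz₀])
  haveI : IsIntegral (pullback (τ ∣_ U) i) := hB.isIntegral hJne
  have hdense := hB.dense_preimage_compl
  -- (4) the image of `B` in `X''`
  let φ : pullback (τ ∣_ U) i ⟶ X'' := pullback.fst (τ ∣_ U) i ≫ (τ ⁻¹ᵁ U).ι
  have hφτ : ∀ b, τ (φ b) = U.ι (i (pullback.snd (τ ∣_ U) i b)) := by
    intro b
    have h1 : (pullback.fst (τ ∣_ U) i ≫ (τ ∣_ U) ≫ U.ι) b = (pullback.snd (τ ∣_ U) i ≫ i ≫ U.ι) b := by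
      rw [pullback.condition_assoc]
    rw [morphismRestrict_ι] at h1
    change τ ((pullback.fst (τ ∣_ U) i ≫ (τ ⁻¹ᵁ U).ι) b) = _
    simpa only [Scheme.Hom.comp_apply, Scheme.Opens.ι_apply] using h1
  -- its part over `Us ∖ {z₀}` maps into `A = τ⁻¹(X'_s ∖ {z₁})`
  set D : (pullback (τ ∣_ U) i).Opens :=
    pullback.snd (τ ∣_ U) i ⁻¹ᵁ centreCompl (Scheme.IdealSheafData.vanishingIdeal ⟨{z₀}, hcl⟩) with hDdef
  have hDA : φ '' (D : Set ↑(pullback (τ ∣_ U) i)) ⊆ τ ⁻¹' (r' ⁻¹' {s₀} \ {s s₀}) := by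
    rintro _ ⟨b, hb, rfl⟩
    have hb' : pullback.snd (τ ∣_ U) i b ∉ ({z₀} : Set _) := by
      intro hmem
      apply hb
      rw [Scheme.IdealSheafData.coe_support_vanishingIdeal]
      exact hmem
    refine ⟨?_, ?_⟩
    · change r' (τ (φ b)) = s₀
      rw [hφτ, ← Scheme.Hom.comp_apply _ r', ← Scheme.Hom.comp_apply]
      exact hrange_i ⟨_, rfl⟩
    · change τ (φ b) ≠ s s₀
      rw [hφτ, ← hsUapp, ← hz₀]
      intro h
      exact hb' (i.isClosedEmbedding.injective (U.ι.isOpenEmbedding.injective h))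
  -- it contains `τ⁻¹(z₁)`
  have hfib : τ ⁻¹' {s s₀} ⊆ Set.range φ := by
    intro x hx
    have hx' : τ x = s s₀ := hx
    have hxU : x ∈ τ ⁻¹ᵁ U := by change τ x ∈ U; rw [hx']; exact hzU
    have h1 : (τ ∣_ U) ⟨x, hxU⟩ = sU s₀ := by
      apply U.ι.isOpenEmbedding.injective
      rw [hsUapp, Scheme.Opens.ι_apply, morphismRestrict_base_coe]
      exact hx'
    obtain ⟨b, hb⟩ : (⟨x, hxU⟩ : ↥(τ ⁻¹ᵁ U)) ∈ Set.range (pullback.fst (τ ∣_ U) i) := by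
      rw [Scheme.Pullback.range_fst]
      change (τ ∣_ U) ⟨x, hxU⟩ ∈ Set.range i
      rw [h1]
      exact ⟨z₀, hz₀⟩
    exact ⟨b, by change (τ ⁻¹ᵁ U).ι (pullback.fst (τ ∣_ U) i b) = x; rw [hb]; rfl⟩
  -- and it lies in the closure of the image of `D` (dense in the integral `B`)
  have hcl2 : Set.range φ ⊆ closure (φ '' (D : Set ↑(pullback (τ ∣_ U) i))) := by
    rw [← Set.image_univ, ← hdense.closure_eq]
    exact image_closure_subset_closure_image φ.continuous
  refine ⟨hfib.trans (hcl2.trans (closure_mono hDA)), u.1, u.2, ?_, ?_⟩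
  · rw [← Scheme.Opens.ι_apply, ← Scheme.Hom.comp_apply]; exact hu0
  · intro h
    apply hune
    apply U.ι.isOpenEmbedding.injective
    rw [hsUapp, Scheme.Opens.ι_apply]
    exact h

/-! ## The registered helper -/

/-- **Blowing up a section keeps the special fibre irreducible.** Let `O` be a discrete valuation ring with closed
point `s₀`, `X'` an integral scheme, `r' : X' → Spec O` separated, `U ⊆ X'` an open smooth over `Spec O`,
`s : Spec O → X'` a section of `r'` with `s(s₀) ∈ U` and `ker s ≠ ⊥`, and `τ : X'' → X'` a blow-up of `X'` along
`ker s`. If the special fibre `r'⁻¹(s₀)` is irreducible then so is `(τ ≫ r')⁻¹(s₀)`: with `z₁ = s(s₀)` and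
`A = τ⁻¹(r'⁻¹(s₀) ∖ {z₁})` (preirreducible and nonempty, `τ` being an isomorphism off the centre), one has
`A ⊆ τ⁻¹(r'⁻¹(s₀)) ⊆ closure A` by `preimage_sectionPoint_subset_closure`. [folklore] -/
theorem isIrreducible_specialFibre_of_isBlowup_section : ∀ (O : Type) [CommRing O] [IsDomain O] [IsDiscreteValuationRing O] (X' X'' : AlgebraicGeometry.Scheme.{0}) [AlgebraicGeometry.IsIntegral X'] (r' : X' ⟶ AlgebraicGeometry.Spec (.of O)) [AlgebraicGeometry.IsSeparated r'] (U : X'.Opens), AlgebraicGeometry.Smooth (CategoryTheory.CategoryStruct.comp U.ι r') → ∀ (s : AlgebraicGeometry.Spec (.of O) ⟶ X'), CategoryTheory.CategoryStruct.comp s r' = CategoryTheory.CategoryStruct.id _ → s (IsLocalRing.closedPoint O) ∈ U → s.ker ≠ ⊥ → ∀ (τ : X'' ⟶ X'), Literature.AlgebraicGeometry.Resolution.IsBlowup τ s.ker → IsIrreducible (r' ⁻¹' {IsLocalRing.closedPoint O}) → IsIrreducible ((CategoryTheory.CategoryStruct.comp τ r') ⁻¹' {IsLocalRing.closedPoint O})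 := by
  intro O _ _ _ X' X'' _ r' _ U hsm s hs hzU hker τ hτ hirr
  obtain ⟨hsCI, -, -, hsupp⟩ := section_isClosedImmersion_and_isRegular_ker O X' r' s hs
  haveI := hsCI
  have hrs : ∀ t, r' (s t) = t := fun t => by
    rw [← Scheme.Hom.comp_apply, hs]; rfl
  -- the local analysis over `U`
  obtain ⟨hkey, u, huU, hu0, hune⟩ :=
    preimage_sectionPoint_subset_closure O X' X'' r' U hsm s hs hzU hker τ hτ hirr
  set s₀ := IsLocalRing.closedPoint O with hs₀def
  set F : Set X' := r' ⁻¹' {s₀} with hFdef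
  have hgoal : (τ ≫ r') ⁻¹' {s₀} = τ ⁻¹' F := by
    ext x
    simp only [hFdef, Set.mem_preimage, Scheme.Hom.comp_apply]
  rw [hgoal]
  -- the points of the special fibre on the centre `C = s(Spec O)` reduce to `z₁ = s(s₀)`
  have hCF : ∀ x ∈ F, x ∈ Set.range s → x = s s₀ := by
    rintro _ hx ⟨t, rfl⟩
    have ht : t = s₀ := by rw [← hrs t]; exact hx
    rw [ht]
  -- `τ` is an isomorphism over the complement `Wc` of the centre
  let Wc : X'.Opens := ⟨(s.ker.support : Set X')ᶜ, s.ker.support.isClosed.isOpen_compl⟩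
  have hWc : IsIso (τ ∣_ Wc) := hτ.isIso_compl
  have hmemWc : ∀ x : X', x ∈ Wc ↔ x ∉ Set.range s := fun x => by
    rw [← hsupp]; rfl
  have hFWc : F ∩ (Wc : Set X') = F \ {s s₀} := by
    ext x
    constructor
    · rintro ⟨hxF, hxW⟩
      exact ⟨hxF, fun hx1 => (hmemWc x).mp hxW (hx1 ▸ ⟨s₀, rfl⟩)⟩
    · rintro ⟨hxF, hx1⟩
      exact ⟨hxF, (hmemWc x).mpr fun hxr => hx1 (hCF x hxF hxr)⟩
  -- `A = τ⁻¹(F ∖ {z₁}) ≅ F ∖ {z₁}` is preirreducible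
  set A : Set X'' := τ ⁻¹' (F \ {s s₀}) with hAdef
  have hApre : IsPreirreducible A := by
    haveI : IsOpenImmersion ((τ ⁻¹ᵁ Wc).ι ≫ τ) := by
      rw [← morphismRestrict_ι]; infer_instance
    have h1 : IsPreirreducible (F ∩ (Wc : Set X')) := isPreirreducible_inter_of_isOpen hirr.2 Wc.2
    have h2 : IsPreirreducible (((τ ⁻¹ᵁ Wc).ι ≫ τ) ⁻¹' (F ∩ (Wc : Set X'))) :=
      h1.preimage ((τ ⁻¹ᵁ Wc).ι ≫ τ).isOpenEmbedding
    have h3 := h2.image (τ ⁻¹ᵁ Wc).ι (τ ⁻¹ᵁ Wc).ι.continuous.continuousOn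
    have heq : ((τ ⁻¹ᵁ Wc).ι : _ → X'') '' (((τ ⁻¹ᵁ Wc).ι ≫ τ) ⁻¹' (F ∩ (Wc : Set X'))) = A := by
      rw [hAdef, ← hFWc]
      ext x
      constructor
      · rintro ⟨y, hy, rfl⟩
        simpa only [Set.mem_preimage, Scheme.Hom.comp_apply] using hy
      · intro hx
        refine ⟨⟨x, hx.2⟩, ?_, rfl⟩
        simpa only [Set.mem_preimage, Scheme.Hom.comp_apply, Scheme.Opens.ι_apply] using hx
    rw [← heq]
    exact h3
  have hAF : A ⊆ τ ⁻¹' F := fun x hx => hx.1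
  -- `A` is nonempty: the point `u ∈ U ∩ F ∖ {z₁}` lies under the isomorphism `τ ∣_ Wc`
  have huWc : u ∈ Wc := (hmemWc u).mpr fun h => hune (hCF u hu0 h)
  let eW := Scheme.homeoOfIso (asIso (τ ∣_ Wc))
  -- adapted from Summit...Theses.EquisingularLift.Split.existsUnique_preimage
  set x₀ : X'' := (eW.symm ⟨u, huWc⟩).1 with hx₀def
  have hx₀ : τ x₀ = u := by
    have he : ∀ z : ↥(τ ⁻¹ᵁ Wc), (eW z).1 = τ z.1 := fun z => morphismRestrict_base_coe τ Wc z
    rw [hx₀def, ← he, eW.apply_symm_apply]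
  have hx₀A : x₀ ∈ A := by
    refine ⟨?_, ?_⟩
    · rw [hx₀]; exact hu0
    · rw [hx₀]; exact hune
  -- conclusion: `A ⊆ τ⁻¹ F ⊆ closure A`
  refine ⟨⟨x₀, hAF hx₀A⟩, isPreirreducible_of_subset_closure hApre hAF fun y hy => ?_⟩
  by_cases h : τ y = s s₀
  · exact hkey h
  · exact subset_closure ⟨hy, h⟩

end Summit.ResolutionOfSingularities.ResolutionOfSingularities.Cruxes.EquisingularLift.StrataSplit

end
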